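import Summits.CriticalPhenomena.PercolationContinuityZ3.Theorems.PercNearOneGluingNoHeavyQuantWindowExtremePieces
import HarnessLib

/-!
# QUANT lane R8, T-DEC: extreme points of the window polytope are small — the case WITHOUT a saturated layer (memo WINDOW-ATOMS-G57
# §2.4 case (C), file H5 part 4): one elementary piece is a two-sided move, so the law is a point or a pair

builds on p205010 (kernel theorem, internal audit signed; external expert review pending)

Support file (`--supports stmt-CriticalPhenomena-4575`), QUANT lane seat prim-quant-census-2 (gen 57), rung R8 of
`run/shared/lean/prim/quant/LADDER.md`.  One theorem, standard axioms, no sorries.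

* **`LawDec.smallLaw_of_noTight`** — if `v` is an extreme point of `windowSet x T M j w` (`0 < x < 1`) and NO unflipped window layer has a
  nonempty, exactly saturated giant pool, then `SmallLaw T j M (vecLaw M v)`.  The piece: a giant of positive mass if there is one; else a
  corner segment if there is one; else an absorber of positive mass (its residual capacity is its mass).  `smallLaw_of_pieces` concludes.

[this work]; nothing here is cited as a published result.  The gluing rows served [cite: KozmaNitzan2024, Conjecture 3 (p. 15)]; product
measure [cite: Grimmett1999, §1.3 p. 10].
-/

noncomputable section

namespace Summit.CriticalPhenomena.PercolationContinuityZ3.Theorems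

namespace Quant

open Finset

namespace LawDec

/-- indicator of equality of naturals, as a real number -/
local notation3 "𝟙[" a ", " b "]" => (if (a : ℕ) = (b : ℕ) then (1 : ℝ) else 0)

/-- **THE CASE WITHOUT A SATURATED LAYER** (memo §2.4 (C)). [this work] -/
theorem smallLaw_of_noTight (x T : ℝ) (M j w : ℕ) (v : Fin (M + 1) → ℝ) (hx0 : 0 < x) (hx1 : x < 1)
    (hvext : v ∈ (windowSet x T M j w).extremePoints ℝ)
    (hno : ∀ J, J ≤ j → j ≤ J + w → (∀ l, J < l → l ≤ j → 2 * (l : ℝ) < T → vecLaw M v l = 0) →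
      x / (1 - x) * windowS x T j M (vecLaw M v) J = ∑ h ∈ Finset.Ico (J + 1) (M + 1), vecLaw M v h →
      0 < ∑ h ∈ Finset.Ico (J + 1) (M + 1), vecLaw M v h → False) :
    SmallLaw T j M (vecLaw M v) := by
  classical
  have hv : v ∈ windowSet x T M j w := hvext.1
  set μ : ℕ → ℝ := vecLaw M v with hμdef
  have hμ0 : ∀ k, 0 ≤ μ k := fun k => by
    by_cases hk : k < M + 1
    · rw [hμdef, vecLaw_apply_of_lt v hk]; exact hv.1 _
    · rw [hμdef, vecLaw, dif_neg hk]
  have hμM : ∀ h, M < h → μ h = 0 := fun h hh => vecLaw_apply_of_gt v hh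
  have hμ1 : ∑ h ∈ Finset.range (M + 1), μ h = 1 := by rw [hμdef, sum_range_vecLaw, hv.2.1]
  have hwin : ∀ J, J ≤ j → j ≤ J + w → DECAtT x T J M μ := hv.2.2
  have hu : 0 < x / (1 - x) := div_pos hx0 (by linarith)
  obtain ⟨hF0, hsup, hrow, hcol⟩ := cornerFlow_inv x T j M μ hx0 hx1 hμ0 ((j + 1) * (j + 1)) le_rfl
  have hleM : ∀ b, 0 < μ b → b ≤ M := fun b hb => by
    by_contra hgt; push Not at hgt; linarith [hμM b hgt]
  have hG : ∀ J, J ≤ j → j ≤ J + w → (∀ l, J < l → l ≤ j → 2 * (l : ℝ) < T → μ l = 0) →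
      x / (1 - x) * windowS x T j M μ J = ∑ h ∈ Finset.Ico (J + 1) (M + 1), μ h →
      0 < ∑ h ∈ Finset.Ico (J + 1) (M + 1), μ h → ∀ G : ℝ, G = 0 :=
    fun J h1 h2 h3 h4 h5 _ => (hno J h1 h2 h3 h4 h5).elim
  -- the load of a column and the giants
  have hloadgiant : ∀ g, j < g → ∑ a ∈ Finset.range (j + 1), usage x T j a g * cornerMidFlow x T j M μ a g = 0 := by
    intro g hg
    refine Finset.sum_eq_zero fun a _ => ?_
    by_cases hz : cornerMidFlow x T j M μ a g = 0
    · rw [hz, mul_zero]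
    · have := (hsup a g hz).2.1; omega
  by_cases hgiant : ∃ g, j < g ∧ g ≤ M ∧ μ g ≠ 0
  · -- (C1) a giant of positive mass: the piece `e_g`
    obtain ⟨g, hjg, hgM, hgne⟩ := hgiant
    have hgpos : 0 < μ g := lt_of_le_of_ne (hμ0 g) (Ne.symm hgne)
    refine smallLaw_of_pieces x T M j w v hx0 hx1 hvext 0 0 0 0 g 0 0 0 0 1 0 0
      (fun h => absurd rfl h) (fun h => absurd rfl h)
      (fun _ => ⟨hgM, fun hc => by omega, by rw [← hμdef, hloadgiant g hjg, sub_zero]; exact hgpos⟩)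
      (fun h => absurd rfl h) (fun h => absurd rfl h)
      (fun J h1 h2 h3 h4 h5 => hG J h1 h2 h3 h4 h5 _) g hgM ?_ g g g g hgM hgM (Or.inr (by omega)) (Or.inr (by omega))
      (fun k hk => ?_)
    · unfold pertLaw; simp
    · rcases pert_support x T j μ 0 0 0 0 g 0 0 0 0 1 0 0 k hk with ⟨ht, -⟩ | ⟨ht, -⟩ | ⟨-, hk'⟩ | ⟨hs, -⟩ | ⟨hr, -⟩
      · exact absurd rfl ht
      · exact absurd rfl ht
      · exact Or.inl hk'
      · exact absurd rfl hs
      · exact absurd rfl hr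
  · push Not at hgiant
    -- no giant mass: every leftover vanishes
    have hΓj : ∑ h ∈ Finset.Ico (j + 1) (M + 1), μ h = 0 :=
      Finset.sum_eq_zero fun h hh => by
        obtain ⟨q1, q2⟩ := Finset.mem_Ico.1 hh
        exact hgiant h (by omega) (by omega)
    have hleft0 : ∀ l, 0 ≤ cornerLeftover x T j M μ l := fun l => by
      unfold cornerLeftover cornerMidFlow; linarith [hrow l]
    have hCj := (decAtT_iff_cornerSucceeds x T j M μ hx0 hx1 hμ0 hμM hμ1).1 (hwin j le_rfl (Nat.le_add_right _ _))
    unfold CornerSucceeds at hCj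
    rw [hΓj] at hCj
    have hLsum : ∑ l ∈ (Finset.range (j + 1)).filter (fun l : ℕ => 2 * (l : ℝ) < T), cornerLeftover x T j M μ l = 0 := by
      have h0 : 0 ≤ ∑ l ∈ (Finset.range (j + 1)).filter (fun l : ℕ => 2 * (l : ℝ) < T), cornerLeftover x T j M μ l :=
        Finset.sum_nonneg fun l _ => hleft0 l
      nlinarith
    have hLz : ∀ l, l ≤ j → 2 * (l : ℝ) < T → cornerLeftover x T j M μ l = 0 := fun l hl hlow =>
      (Finset.sum_eq_zero_iff_of_nonneg (fun l _ => hleft0 l)).1 hLsum l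
        (Finset.mem_filter.2 ⟨Finset.mem_range.2 (Nat.lt_succ_of_le hl), hlow⟩)
    by_cases hseg : ∃ l h, 0 < cornerMidFlow x T j M μ l h
    · -- (C2) a corner segment: the piece `e_l + c·e_h`
      obtain ⟨l, h, hF⟩ := hseg
      obtain ⟨q1, q2, q3, q4, q5, -⟩ := hsup l h (ne_of_gt hF)
      have hlh : l ≠ h := by
        intro e; have : (l : ℝ) = h := by exact_mod_cast e
        linarith
      refine smallLaw_of_pieces x T M j w v hx0 hx1 hvext l h 0 0 0 0 0 1 0 0 0 0
        (fun _ => hF) (fun h => absurd rfl h) (fun h => absurd rfl h) (fun h => absurd rfl h) (fun h => absurd rfl h)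
        (fun J h1 h2 h3 h4 h5 => hG J h1 h2 h3 h4 h5 _) l (hleM l ?_) ?_ l l h h q4 q4 (Or.inl (by linarith)) (Or.inl (by linarith))
        (fun k hk => ?_)
      · -- the low of a segment has positive mass
        have hle := Finset.single_le_sum (f := fun b => cornerFlow x T j M μ ((j + 1) * (j + 1)) l b) (fun b _ => hF0 l b)
          (Finset.mem_range.2 (Nat.lt_succ_of_le q4))
        have hF' : 0 < cornerFlow x T j M μ ((j + 1) * (j + 1)) l h := hF
        linarith [hrow l]
      · unfold pertLaw; rw [if_pos rfl, if_neg hlh]; simp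
      · rcases pert_support x T j μ l h 0 0 0 0 0 1 0 0 0 0 k hk with ⟨-, hk'⟩ | ⟨ht, -⟩ | ⟨hs, -⟩ | ⟨hs, -⟩ | ⟨hr, -⟩
        · rcases hk' with e | e
          · exact Or.inl e
          · exact Or.inr (Or.inr (Or.inl e))
        · exact absurd rfl ht
        · exact absurd rfl hs
        · exact absurd rfl hs
        · exact absurd rfl hr
    · -- (C3) no segment, no giant mass: an absorber of positive mass, with its whole mass as residual capacity
      push Not at hseg
      have hFz : ∀ l h, cornerMidFlow x T j M μ l h = 0 := fun l h => le_antisymm (hseg l h) (hF0 l h)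
      obtain ⟨b, hbmem, hbne⟩ : ∃ b ∈ Finset.range (M + 1), μ b ≠ 0 :=
        Finset.exists_ne_zero_of_sum_ne_zero (by rw [hμ1]; exact one_ne_zero)
      have hbM : b ≤ M := Nat.lt_succ_iff.1 (Finset.mem_range.1 hbmem)
      have hbpos : 0 < μ b := lt_of_le_of_ne (hμ0 b) (Ne.symm hbne)
      have hbj : b ≤ j := by
        by_contra hgt; push Not at hgt; exact hbne (hgiant b hgt hbM)
      have hnotlow : ¬ (2 * (b : ℝ) < T ∧ b ≤ j) := by
        rintro ⟨hlow, -⟩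
        -- a low's mass is its corner row plus its leftover, both zero
        have hL := hLz b hbj hlow
        unfold cornerLeftover at hL
        rw [Finset.sum_eq_zero (fun h _ => hFz b h)] at hL
        exact hbne (by linarith)
      have hload0 : ∑ a ∈ Finset.range (j + 1), usage x T j a b * cornerMidFlow x T j M μ a b = 0 :=
        Finset.sum_eq_zero fun a _ => by rw [hFz a b, mul_zero]
      have habs : T ≤ 2 * (b : ℝ) := by
        by_contra hlt; push Not at hlt; exact hnotlow ⟨hlt, hbj⟩
      refine smallLaw_of_pieces x T M j w v hx0 hx1 hvext 0 0 0 0 b 0 0 0 0 1 0 0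
        (fun h => absurd rfl h) (fun h => absurd rfl h)
        (fun _ => ⟨hbM, hnotlow, by rw [← hμdef, hload0, sub_zero]; exact hbpos⟩)
        (fun h => absurd rfl h) (fun h => absurd rfl h)
        (fun J h1 h2 h3 h4 h5 => hG J h1 h2 h3 h4 h5 _) b hbM ?_ b b b b hbM hbM (Or.inl habs) (Or.inl habs)
        (fun k hk => ?_)
      · unfold pertLaw; simp
      · rcases pert_support x T j μ 0 0 0 0 b 0 0 0 0 1 0 0 k hk with ⟨ht, -⟩ | ⟨ht, -⟩ | ⟨-, hk'⟩ | ⟨hs, -⟩ | ⟨hr, -⟩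
        · exact absurd rfl ht
        · exact absurd rfl ht
        · exact Or.inl hk'
        · exact absurd rfl hs
        · exact absurd rfl hr

end LawDec

end Quant

end Summit.CriticalPhenomena.PercolationContinuityZ3.Theorems
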